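import Literature.Computability.MetaComplexity.BoundedArithS2LIND
import HarnessLib

/-!
# Models of `S₂¹ = BASIC + Σᵇ₁-PIND` as ordered commutative semirings; monotone terms

Topic `Literature/Computability/MetaComplexity`.  The `S₂¹` analogue of the `T₂¹` tier of
`BoundedArithAlgebra.lean`: the first layer of the bootstrapping of Buss's `S₂¹` *inside an
arbitrary model* `M ⊨ BASIC + Σᵇ₁-PIND` (Buss 1986, Ch. 2), in the algebraic notation of the
namespace `BASICModel`.  The hypotheses are the instance arguments `[M ⊨ BASIC]` and
`[M ⊨ PINDScheme (sigmabFormulas 1)]` (a model of `S₂¹` provides both), mirroring the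
`[M ⊨ INDScheme (sigmabFormulas 1)]` of the `T₂¹` tier; the two tiers are independent (neither
scheme is available in the other theory's models in general).

* the induction principles of `S₂¹` in algebraic notation: `Σᵇ₁-PIND` (`pind`), `Σᵇ₀-IND`
  (`ind0`, from `BASICModel.ind_of_pind_succ`: Buss 1990, §1), `Σᵇ₁-LIND` (`lind`) and
  `Σᵇ₁`-induction along an interval of lengths (`indLen`) (`BoundedArithS2LIND.lean`;
  Krajíček 1995, Lemma 5.2.5);
* associativity of `·` (open induction), hence scoped instances `CommSemiring M`,
  `IsStrictOrderedRing M` (`instCommSemiringPIND`, `instIsStrictOrderedRingPIND`);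
* every nonzero element is a successor (`Σᵇ₁-PIND`); differences of *lengths*
  (`exists_add_eq_of_le_mLen`: for `i ≤ j ≤ |y|` there is `d` with `i + d = j`);
* monotonicity of `⌊·/2⌋` (from `BASIC` alone: `mHalf_mono`) and of `#` (via differences of
  lengths and axiom 18 — the only place where term monotonicity needs `Σᵇ₁-PIND`), hence
  **every term is monotone** (`realize_term_monotone`, `IsTermFn.le_of_le`), which provides the
  bounding terms of composite `Σᵇ₁`-defined functions (Buss 1986, §2.2–2.3); `a < 1 # a`.

Truncated subtraction and the least-number principle of the `T₂¹` tier are *not* available here.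

## References

* S. R. Buss, *Bounded Arithmetic*, Bibliopolis 1986, Ch. 2 (§§2.2–2.4: `BASIC`, the schemes,
  bootstrapping of `S₂¹`).
* S. R. Buss, *Axiomatizations and conservation results for fragments of bounded arithmetic*,
  Contemp. Math. 106, AMS 1990, §1 (p. 3: `Σᵇᵢ₊₁-PIND ⊢ Σᵇᵢ-IND`).
* J. Krajíček, *Bounded Arithmetic, Propositional Logic and Complexity Theory*, CUP 1995,
  Lemma 5.2.5 (p. 67), §5.4.
-/

namespace Literature.Computability.MetaComplexity

open FirstOrder FirstOrder.Language

namespace BASICModel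

variable {M : Type} [Language.boundedArith.Structure M]

section S21

variable [hB : M ⊨ BASIC] [hP : M ⊨ PINDScheme (sigmabFormulas 1)]

/-! ## The induction principles of `S₂¹`, algebraic notation -/

/-- **`Σᵇ₁-PIND`** in a model of `BASIC + Σᵇ₁-PIND`, algebraic notation: `A(0)` and
`∀a (A(⌊a/2⌋) → A(a))` give `∀a A(a)` for `Σᵇ₁`-definable `A` (Buss 1986, §2.4, Definition of
`S₂¹`). [cite: Buss1986, §2.4] -/
theorem pind {A : M → Prop} (hA : IsSigmabDef 1 fun v : Fin 1 → M => A (v 0)) (h0 : A 0)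
    (hs : ∀ a, A (mHalf a) → A a) (a : M) : A a :=
  hA.pinduction' hP h0 hs a

/-- **`Σᵇ₀-IND`** (induction for sharply bounded, in particular open, predicates with
parameters) in a model of `BASIC + Σᵇ₁-PIND` (Buss 1990, §1, p. 3: the `Σᵇᵢ₊₁-PIND` axioms imply
the `Σᵇᵢ-IND` axioms; `BASICModel.ind_of_pind_succ`). [cite: BussContempMath1990, §1 (p. 3)] -/
theorem ind0 {A : M → Prop} (hA : IsSigmabDef 0 fun v : Fin 1 → M => A (v 0)) (h0 : A 0)
    (hs : ∀ a, A a → A (a + 1)) (a : M) : A a :=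
  ind_of_pind_succ (j := 0) hP hA h0 hs a

/-- **Open induction** in a model of `BASIC + Σᵇ₁-PIND` (special case of `Σᵇ₀-IND`).
[cite: BussContempMath1990, §1 (p. 3)] -/
theorem qf_ind {A : M → Prop} (hA : IsQFDef fun v : Fin 1 → M => A (v 0)) (h0 : A 0)
    (hs : ∀ a, A a → A (a + 1)) (a : M) : A a :=
  ind0 (hA.isSigmabDef 0) h0 hs a

/-- **`Σᵇ₁-LIND`** in a model of `BASIC + Σᵇ₁-PIND`, algebraic notation (Krajíček 1995,
Lemma 5.2.5, p. 67: `S₂¹ ⊢ Σᵇ₁-LIND`; `BASICModel.lind_of_pind`). [cite: Krajicek1995, Lemma 5.2.5 (p. 67)] -/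
theorem lind {A : M → Prop} (hA : IsSigmabDef 1 fun v : Fin 1 → M => A (v 0)) (h0 : A 0)
    (hs : ∀ k, A k → A (k + 1)) (a : M) : A (mLen a) :=
  lind_of_pind hP hA h0 hs a

/-- **`Σᵇ₁`-induction along the interval of lengths `[0, |a|]`** in a model of
`BASIC + Σᵇ₁-PIND` (`BASICModel.ind_le_mLen_of_pind`). [cite: Krajicek1995, Lemma 5.2.5 (p. 67)] -/
theorem indLen {A : M → Prop} (hA : IsSigmabDef 1 fun v : Fin 1 → M => A (v 0)) (a : M)
    (h0 : A 0) (hs : ∀ k, k < mLen a → A k → A (k + 1)) {k : M} (hk : k ≤ mLen a) : A k :=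
  ind_le_mLen_of_pind (i := 0) hP hA a h0 hs hk

/-- Every `k ≤ |a|` is a length `|y|`, `y ≤ a` (`BASICModel.exists_le_mLen_eq`).
[cite: Buss1986, Ch. 2] -/
theorem exists_mLen_eq {a k : M} (hk : k ≤ mLen a) : ∃ y, y ≤ a ∧ mLen y = k :=
  exists_le_mLen_eq hP a hk

/-! ## Multiplication is associative: `CommSemiring`, `IsStrictOrderedRing` -/

/-- `·` is associative in a model of `BASIC + Σᵇ₁-PIND`: open induction on `c`
(Buss 1986, §2.3). [cite: Buss1986, §2.3] -/
theorem mul_assoc_pind (a b c : M) : a * b * c = a * (b * c) := by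
  refine qf_ind (A := fun c => a * b * c = a * (b * c)) ?_ (by simp) (fun c hc => ?_) c
  · exact IsQFDef.eq (((IsTermFn.const a).mul (IsTermFn.const b)).mul (IsTermFn.proj 0))
      ((IsTermFn.const a).mul ((IsTermFn.const b).mul (IsTermFn.proj 0)))
  · rw [mul_add, mul_add, mul_add, hc, mul_one, mul_one]

/-- A model of `BASIC + Σᵇ₁-PIND` is a commutative semiring (Buss 1986, §2.3). [cite: Buss1986, §2.3] -/
scoped instance instCommSemiringPIND : CommSemiring M :=
  { BASICModel.instNonAssocSemiring with
    mul_assoc := mul_assoc_pind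
    mul_comm := mul_comm_model }

/-- A model of `BASIC + Σᵇ₁-PIND` is a strictly ordered semiring (axioms 25, 30).
[cite: Buss1986, §2.3] -/
scoped instance instIsStrictOrderedRingPIND : IsStrictOrderedRing M where
  add_le_add_left a b h c := add_le_add_left h c
  le_of_add_le_add_left a b c h := le_of_add_le_add_left h
  zero_le_one := zero_le_one
  exists_pair_ne := ⟨0, 1, zero_ne_one⟩
  mul_lt_mul_of_pos_left a ha b c hbc := by
    have ha' : 1 ≤ a := (one_le_iff_ne_zero' a).2 ha.ne'
    rw [lt_iff_not_ge] at hbc ⊢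
    exact fun h => hbc ((mul_le_mul_iff_left' ha' c b).1 h)
  mul_lt_mul_of_pos_right a ha b c hbc := by
    have ha' : 1 ≤ a := (one_le_iff_ne_zero' a).2 ha.ne'
    rw [lt_iff_not_ge] at hbc ⊢
    rw [mul_comm b a, mul_comm c a]
    exact fun h => hbc ((mul_le_mul_iff_left' ha' c b).1 h)

/-! ## Successors, differences of lengths -/

/-- **Every nonzero element is a successor**, in a model of `BASIC + Σᵇ₁-PIND`: by `Σᵇ₁-PIND` on
`a` for `a = 0 ∨ ∃b ≤ a (a = b + 1)` — if `a = 2h + 1` take `b = 2h`, if `a = 2h` with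
`h = h' + 1` take `b = 2h' + 1` (bootstrapping of `S₂¹`, Buss 1986, Ch. 2). [cite: Buss1986, Ch. 2] -/
theorem exists_eq_add_one_of_ne_zero_pind {a : M} (ha : a ≠ 0) : ∃ b, a = b + 1 := by
  suffices H : a = 0 ∨ ∃ b, b ≤ a ∧ a = b + 1 by
    rcases H with h | ⟨b, -, h⟩
    · exact absurd h ha
    · exact ⟨b, h⟩
  refine pind (A := fun a => a = 0 ∨ ∃ b, b ≤ a ∧ a = b + 1) ?_ ?_ ?_ a
  · refine ((IsQFDef.eq (IsTermFn.proj 0) isTermFn_zero).isSigmabDef 1).or ?_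
    exact (IsSigmabDef.bexLE (i := 0)
      ((IsQFDef.eq (IsTermFn.proj 0) (isTermFn_add_one (IsTermFn.proj 1))).isSigmabDef 1)
      (IsTermFn.proj 0)).of_iff fun v => by simp
  · exact Or.inl rfl
  · intro a ih
    rcases two_mul_mHalf_or a with h | h
    · rcases ih with h0 | ⟨b, -, hb⟩
      · left
        rw [← h, h0, mul_zero]
      · right
        refine ⟨2 * b + 1, ?_, ?_⟩
        · rw [← h, hb]
          calc 2 * b + 1 ≤ 2 * b + 1 + 1 := le_add_right'' _ _
            _ = 2 * (b + 1) := by ring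
        · rw [← h, hb]; ring
    · exact Or.inr ⟨2 * mHalf a, le_of_le_of_eq (le_add_right'' _ _) h, h.symm⟩

/-- `a ≠ 0 ↔ ∃ b, a = b + 1`. [cite: Buss1986, Ch. 2] -/
theorem ne_zero_iff_exists_add_one (a : M) : a ≠ 0 ↔ ∃ b, a = b + 1 :=
  ⟨exists_eq_add_one_of_ne_zero_pind, by rintro ⟨b, rfl⟩; exact (lt_add_one' b).ne_bot⟩

omit hP in
/-- `i ≤ j + 1 ↔ i ≤ j ∨ i = j + 1` (discreteness). [folklore] -/
theorem le_add_one_iff' (i j : M) : i ≤ j + 1 ↔ i ≤ j ∨ i = j + 1 := by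
  constructor
  · intro h
    rcases h.eq_or_lt with h | h
    · exact Or.inr h
    · exact Or.inl ((lt_add_one_iff' i j).1 h)
  · rintro (h | rfl)
    · exact le_add_one_of_le _ _ h
    · exact le_rfl

/-- **Differences of lengths**: in a model of `BASIC + Σᵇ₁-PIND`, for `i ≤ j ≤ |y|` there is
`d ≤ j` with `i + d = j` (whereas differences of arbitrary elements require more bootstrapping).
Proof: `Σᵇ₁`-induction on `j` along `[0, |y|]` for the `Σᵇ₁` formula
`∀ i ≤ |y| (i ≤ j → ∃ d ≤ j, i + d = j)` (Buss 1986, Ch. 2). [cite: Buss1986, Ch. 2] -/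
theorem exists_add_eq_of_le_mLen {y i j : M} (hj : j ≤ mLen y) (hij : i ≤ j) :
    ∃ d, d ≤ j ∧ i + d = j := by
  have key : ∀ i, i ≤ mLen y → i ≤ j → ∃ d, d ≤ j ∧ i + d = j := by
    refine indLen (A := fun j => ∀ i, i ≤ mLen y → i ≤ j → ∃ d, d ≤ j ∧ i + d = j) ?_ y ?_ ?_ hj
    · have h3 : IsSigmabDef 1 fun u : Fin 3 → M => u 1 + u 2 = u 0 :=
        (IsQFDef.eq ((IsTermFn.proj 1).add (IsTermFn.proj 2)) (IsTermFn.proj 0)).isSigmabDef 1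
      have h2 : IsSigmabDef 1 fun w : Fin 2 → M => w 1 ≤ w 0 → ∃ d, d ≤ w 0 ∧ w 1 + d = w 0 :=
        IsSigmabDef.imp ((isQFDef_le (IsTermFn.proj 1) (IsTermFn.proj 0)).isPibDef 1)
          ((IsSigmabDef.bexLE (i := 0) h3 (IsTermFn.proj 0)).of_iff fun w => by simp)
      exact (IsSigmabDef.ballLELen (i := 0) h2 (IsTermFn.const y)).of_iff fun v => by simp
    · intro i _ hi
      exact ⟨0, le_rfl, by rw [le_antisymm hi bot_le, add_zero]⟩
    · intro j _ ih i hiy hij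
      rcases (le_add_one_iff' i j).1 hij with h | rfl
      · obtain ⟨d, hd, rfl⟩ := ih i hiy h
        exact ⟨d + 1, by simpa using hd, (add_assoc i d 1).symm⟩
      · exact ⟨0, bot_le, add_zero _⟩
  exact key i (hij.trans hj) hij

/-- Differences below a length: for `i ≤ |y|` there is `d` with `i + d = |y|`. [cite: Buss1986, Ch. 2] -/
theorem exists_add_eq_mLen {y i : M} (hi : i ≤ mLen y) : ∃ d, d ≤ mLen y ∧ i + d = mLen y :=
  exists_add_eq_of_le_mLen le_rfl hi

/-! ## Monotonicity of the operations and of terms -/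

omit hP in
/-- `⌊·/2⌋` is monotone, in every model of `BASIC` (`2⌊y/2⌋ + 2 ≤ 2⌊x/2⌋ ≤ x ≤ y ≤ 2⌊y/2⌋ + 1` is
absurd); this `BASIC`-level statement subsumes `mHalf_le_mHalf` of the `T₂¹` tier.
[cite: Buss1986, §2.2] -/
theorem mHalf_mono {x y : M} (h : x ≤ y) : mHalf x ≤ mHalf y := by
  by_contra hlt
  rw [not_le, ← add_one_le_iff'] at hlt
  have h1 : 2 * mHalf y + 1 + 1 ≤ 2 * mHalf x := by
    have := (two_mul_le_two_mul_iff _ _).2 hlt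
    calc 2 * mHalf y + 1 + 1 = 2 * (mHalf y + 1) := by
          rw [mul_add, mul_one, add_assoc, one_add_one_eq_two]
      _ ≤ 2 * mHalf x := this
  have h2 : 2 * mHalf x ≤ x := by
    rcases two_mul_mHalf_or x with e | e
    · exact e.le
    · calc 2 * mHalf x ≤ 2 * mHalf x + 1 := le_add_right'' _ _
        _ = x := e
  have h3 : y ≤ 2 * mHalf y + 1 := by
    rcases two_mul_mHalf_or y with e | e
    · calc y = 2 * mHalf y := e.symm
        _ ≤ 2 * mHalf y + 1 := le_add_right'' _ _
    · exact e.ge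
  have := ((h1.trans h2).trans h).trans h3
  exact (lt_add_one' (2 * mHalf y + 1)).not_ge this

/-- **`#` is monotone in the first argument** in a model of `BASIC + Σᵇ₁-PIND`: with `d` such that
`|x| + d = |x'|` (differences of lengths) and `v ≤ x'` of length `d` (every small number is a
length), axiom 18 gives `x' # y = (x # y)·(v # y) ≥ x # y` (Buss 1986, §2.3). [cite: Buss1986, §2.3] -/
theorem mSmash_mono_left {x x' : M} (h : x ≤ x') (y : M) : mSmash x y ≤ mSmash x' y := by
  obtain ⟨d, hd, hxd⟩ := exists_add_eq_mLen (mLen_le_mLen h)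
  obtain ⟨v, -, hv⟩ := exists_mLen_eq hd
  rw [mSmash_eq_mul_of_mLen_eq_add (x := x') (u := x) (v := v) (by rw [hv, hxd]) y]
  conv_lhs => rw [← mul_one (mSmash x y)]
  exact mul_le_mul'' le_rfl ((one_le_iff_ne_zero' _).2 (mSmash_ne_zero _ _))

/-- `#` is monotone (Buss 1986, §2.3). [cite: Buss1986, §2.3] -/
theorem mSmash_mono {x x' y y' : M} (hx : x ≤ x') (hy : y ≤ y') : mSmash x y ≤ mSmash x' y' :=
  (mSmash_mono_left hx y).trans (by
    rw [mSmash_comm x' y, mSmash_comm x' y']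
    exact mSmash_mono_left hy x')

/-- **Every term (with parameters) is monotone** in a model of `BASIC + Σᵇ₁-PIND`: each symbol
`S, ⌊·/2⌋, |·|, +, ·, #` is monotone (Buss 1986, §2.3). [cite: Buss1986, §2.3] -/
theorem realize_term_monotone {β : Type} (t : Language.boundedArith.Term (M ⊕ β)) {xs ys : β → M}
    (h : ∀ j, xs j ≤ ys j) : t.realize (Sum.elim id xs) ≤ t.realize (Sum.elim id ys) := by
  induction t with
  | var x =>
    rcases x with a | j
    · exact le_rfl
    · exact h j
  | func f ts ih =>
    simp only [Term.realize]
    cases f with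
    | zero => exact le_of_eq (congrArg _ (Subsingleton.elim _ _))
    | succ =>
      rw [funMap_eq₁, funMap_eq₁ _ (fun i => (ts i).realize (Sum.elim id ys))]
      change mSucc _ ≤ mSucc _
      simpa using ih 0
    | half =>
      rw [funMap_eq₁, funMap_eq₁ _ (fun i => (ts i).realize (Sum.elim id ys))]
      exact mHalf_mono (ih 0)
    | len =>
      rw [funMap_eq₁, funMap_eq₁ _ (fun i => (ts i).realize (Sum.elim id ys))]
      exact mLen_le_mLen (ih 0)
    | add =>
      rw [funMap_eq₂, funMap_eq₂ _ (fun i => (ts i).realize (Sum.elim id ys))]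
      exact add_le_add (ih 0) (ih 1)
    | mul =>
      rw [funMap_eq₂, funMap_eq₂ _ (fun i => (ts i).realize (Sum.elim id ys))]
      exact mul_le_mul'' (ih 0) (ih 1)
    | smash =>
      rw [funMap_eq₂, funMap_eq₂ _ (fun i => (ts i).realize (Sum.elim id ys))]
      exact mSmash_mono (ih 0) (ih 1)

/-- A term in named variables only is monotone in the assignment. [cite: Buss1986, §2.3] -/
theorem realize_term_monotone' {β : Type} (t : Language.boundedArith.Term β) {xs ys : β → M}
    (h : ∀ j, xs j ≤ ys j) : t.realize xs ≤ t.realize ys := by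
  have := realize_term_monotone (M := M) (t.relabel Sum.inr) h
  simpa only [Term.realize_relabel, Sum.elim_comp_inr] using this

/-- **Term functions are monotone** in every argument, in a model of `BASIC + Σᵇ₁-PIND`
(Buss 1986, §2.3). [cite: Buss1986, §2.3] -/
theorem _root_.Literature.Computability.MetaComplexity.IsTermFn.le_of_le {m : ℕ}
    {F : (Fin m → M) → M} (hF : IsTermFn F) {xs ys : Fin m → M} (h : ∀ j, xs j ≤ ys j) :
    F xs ≤ F ys := by
  obtain ⟨t, ht⟩ := hF
  rw [ht, ht]
  exact realize_term_monotone t h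

/-! ## Small conveniences -/

omit hP in
/-- `a ≤ b · a` for `b ≠ 0`. [folklore] -/
theorem le_mul_of_ne_zero (a : M) {b : M} (hb : b ≠ 0) : a ≤ b * a := by
  simpa using mul_le_mul'' ((one_le_iff_ne_zero' b).2 hb) (le_refl a)

omit hP in
/-- `a ≤ a · b` for `b ≠ 0`. [folklore] -/
theorem le_mul_of_ne_zero' (a : M) {b : M} (hb : b ≠ 0) : a ≤ a * b := by
  simpa using mul_le_mul'' (le_refl a) ((one_le_iff_ne_zero' b).2 hb)

/-- **`a < 2^{|a|} = 1 # a`** in a model of `BASIC + Σᵇ₁-PIND` (`1 # a` is a power of two of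
length `|a| + 1`, `BASICModel.isPow_one_mSmash`, and `IsPow.lt_iff_mLen_lt`). [cite: Buss1986, §2.2] -/
theorem lt_one_mSmash (a : M) : a < mSmash 1 a :=
  ((isPow_one_mSmash hP a).lt_iff_mLen_lt a).2 (by rw [mLen_one_mSmash]; exact lt_add_one' _)

omit hP in
/-- `0 ≤ a` (axiom 3), in `≤`-notation. [cite: Buss1986, §2.2] -/
theorem zero_le_model (a : M) : 0 ≤ a := bot_le

omit hP in
/-- `a · b = 0 ↔ a = 0 ∨ b = 0`: if `a, b ≠ 0` then `a · b ≥ b ≥ 1` (axiom 30). [cite: Buss1986, §2.2] -/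
theorem mul_eq_zero_model (a b : M) : a * b = 0 ↔ a = 0 ∨ b = 0 := by
  constructor
  · intro h
    by_contra hne
    push Not at hne
    have h1 : b ≤ a * b := le_mul_of_ne_zero b hne.1
    rw [h] at h1
    exact hne.2 (le_antisymm h1 bot_le)
  · rintro (rfl | rfl)
    · exact zero_mul b
    · exact mul_zero a

omit hP in
/-- A model of `BASIC` has no zero divisors. [cite: Buss1986, §2.2] -/
scoped instance instNoZeroDivisorsModel : NoZeroDivisors M :=
  ⟨fun {a b} h => (mul_eq_zero_model a b).1 h⟩

omit hP in
/-- `0 < a · b ↔ 0 < a ∧ 0 < b`. [folklore] -/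
theorem mul_pos_iff_model (a b : M) : 0 < a * b ↔ 0 < a ∧ 0 < b := by
  simp only [pos_iff_ne_zero', ne_eq, mul_eq_zero_model, not_or]

end S21

end BASICModel

end Literature.Computability.MetaComplexity
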